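import Summits.BirchSwinnertonDyer.BirchSwinnertonDyer.Theorems.ByReductionTypeAtTwoGoodOrdTowerEpsCocycle
import Summits.BirchSwinnertonDyer.BirchSwinnertonDyer.Theorems.ByReductionTypeAtTwoGoodOrdTowerEpsNorm
import HarnessLib

/-!
# Route `ByReductionTypeAtTwo`, item `OrdKatoHalfAtTwo` (stmt-BirchSwinnertonDyer-19271), TOWER road, the
# GOOD-ORDINARY local constant at `v ∣ 2`: KERNEL BRICK ε4 — THE ε-STEP: under `Δ_min ≡ ±3 (mod 8)` every
# `2`-torsion coinvariant class of `E(K̄_v)^{H_∞}` reduces to `0`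

HONEST FRAMING (cell `bsd-2adic`, run/shared/lean/pub/bsd-2adic/, seat `bsd-2adic-tower-1` GEN 18, HUMAN RULINGS
D-0036 / D-0054 / D-0074; wake item «IMC-LKε kernelisation», planner RC-201, HOME/plan/WAKE-IDLE-2ADIC-IMC-LKeps-kernelisation.md):
TOOL theorem only (no definition, no named fact, no `sorry`); closes nothing by itself; nothing booked; BSD is not proved by
any of this. Fourth brick of the ε-REFINEMENT of the GEN 11 kernel theorem `GoodOrdTower.pTorsion_localTowerKer_at_two_le_four_kernel`
to `≤ 2` under `Δ_min ≡ ±3 (mod 8)` (cell `bsd-f1-sign2`'s IMC-LKε⁻≤, `F1Sign2.LocalKernelOneBitOffNormAtTwoLe`; MEMO-imc §10.45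
(c): «the ONLY new mathematics is the ε-step in coinvariant language»). Setting of the GEN 11 assembly: `W/ℚ` globally
minimal, good ordinary at `2`, `κ` cyclotomic, `v ∋ 2`, `K = ℚ_v`, `Γ = Gal(K̄_v/K)`, `H_∞ ⊴ H_n ≤ Γ` the local tower
subgroups, `g ∈ I_K ∩ H_n` an inertial topological generator over `H_∞`, `red₀ : E(K̄_v) → Ẽ(k̄)` the reduction map of the
local integral model, `P₁` the (rational) formal `2`-torsion point.

* **`localRed_eq_zero_of_two_nsmul_eq_smul_sub`** — (hε_n), at EVERY layer `n ≥ 0`: if `Δ_W = m` with `m ≡ 3, 5 (mod 8)`,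
  then for `x, y ∈ E(K̄_v)^{H_∞}` with `2x = g y − y` one has `red₀ x = 0`.
  PROOF. Suppose `red₀ x ≠ 0`. (1) Normalise `red₀ y = 0` (subtract the Hensel lift of `red₀ y` to `E(ℚ_v)`, BRICK G4) and
  halve `y = 2Y` inside the formal group. (2) BRICK ε1 gives the inflated cocycle `c` of `[x]` on `H_n` (`c(g) = x`,
  `2c = ∂y`, `red₀ ∘ c = 0` on `H_{n+1}`); `ξ := c − ∂Y` is an `E[2]`-valued cocycle of `H_n` with `ξ(H_{n+1}) ⊆ {0, P₁}`
  and `Q₀ := ξ(g) ∈ E[2] ∖ {0, P₁}` (it reduces to `red₀ x ≠ 0`). (3) `a := ξ|_{H_{n+1}}` is a continuous character, and the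
  cocycle identity at `gτ = (gτg⁻¹)g` gives the CONJUGATION LAW `a(gτg⁻¹) = a(τ) + χ(τ)`, `χ(σ) := [σQ₀ ≠ Q₀]` (a character
  of `Γ`, `σ Q₀ − Q₀ ∈ {0, P₁}`). (4) `χ` is the Kummer character of `s := √Δ`, a polynomial in the abscissae of `P₁` and
  `Q₀` (BRICK ε2 `sq_eq_Δ_of_two_torsion_abscissae`); Hilbert 90 (BRICK ε2 `exists_smul_eq_ite_neg_of_contHom`) gives
  `β ∈ K̄ˣ` with `τβ = (−1)^{a(τ)}β` on `H_{n+1}`. (5) `θ := β · gβ · s` and `β²` are `H_{n+1}`-fixed, `θ² = β² · g(β²) · Δ`,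
  `gθ = ±θ`; so `f := β² Δ / θ` is `H_{n+1}`-fixed with `f · g f = ±Δ = ±m`. (6) Both `m` and `−m` are `≡ 3, 5 (mod 8)`, so
  this contradicts NS2 BRICK 15 `MultTowerNS2.prod_smul_ne_pow_of_tateUnit` (`k = 0`, `R = 1`: no element of the layer
  `F_{n+1}` has `g`-orbit product a `2`-adic unit `≡ ±3 (mod 8)` — class field axiom + the norm group of `F_{n+1}`).
  Layer `0` is Kramer 1981 Prop. 5 (`i(ℚ₂(√2)/ℚ₂) = 1 ⟺ (Δ, 2)_{ℚ₂} = −1`) + Greenberg L.3.4; the ramified layers `n ≥ 1`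
  are not in print (cell `bsd-f1-sign2`, REF2 v16 §40, MEMO-imc §10.46 (d)) — this file proves them all at once.
  Steps (0) (the `2`-torsion package) and (5)–(6) (the Kummer endgame) are the two theorems of BRICK ε3
  (`…GoodOrdTowerEpsNorm`: `goodOrd_two_torsion_package`, `false_of_kummer_conjugation_law`).

References: R. Greenberg, LNM 1716 (1999), §2 Props. 2.2–2.5, §3 Lemma 3.4 (p. 89); K. Kramer, *Arithmetic of elliptic curves
upon quadratic extension*, Trans. AMS 264 (1981), Prop. 5 (p. 127); J.-P. Serre, *Local Fields* X §1, XIV; J. Neukirch, *ANT*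
V (1.1); cell memos pub/bsd-f1-sign2/MEMO-imc.md §10.35, §10.45–§10.46 and MEMO-imc-data/SCOPE-IMC-LKeps-kernel-g5.md.
-/

set_option autoImplicit false
-- the Theorems namespace of this sub repeats the summit name by design (D-0017 nested layout: Summit.<S>.<Sub>)
set_option linter.dupNamespace false

noncomputable section

open scoped Classical NNReal

namespace Summit.BirchSwinnertonDyer.BirchSwinnertonDyer.Theorems.GoodOrdTower

open NumberField IsDedekindDomain Field PadicInt Literature.NumberTheory.EllipticCurves
  Literature.NumberTheory.GaloisRepresentations IsDedekindDomain.HeightOneSpectrum Rat.HeightOneSpectrum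
  Literature.NumberTheory.EllipticCurves.FormalGroupChart Literature.NumberTheory.EllipticCurves.ResKernel
  Literature.NumberTheory.EllipticCurves.Rank1Residual WeierstrassCurve

set_option maxHeartbeats 800000 in
/-- **THE ε-STEP (hε_n) at a good ORDINARY `2` with `Δ_min ≡ ±3 (mod 8)`, every layer `n`.** For `W/ℚ` globally minimal,
good ordinary at `2`, with `Δ_W = m`, `m ≡ 3` or `5 (mod 8)`; for the cyclotomic `κ`, `v ∋ 2`, `red₀` the reduction map of
the local integral model on `E(K̄_v)`, and `g ∈ I_{ℚ_v} ∩ H_n` a topological generator of `H_n` over `H_∞`: if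
`x, y ∈ E(K̄_v)^{H_∞}` satisfy `2x = g y − y`, then `red₀ x = 0` — every `2`-torsion class of the coinvariants
`E(K̄_v)^{H_∞}/(g − 1)` lies in the image of the formal group, i.e. the étale factor `#Ẽ(k̄)[2]` of the GEN 11 dévissage is
not realised. See the module docstring for the proof (cocycle `ξ = c − ∂Y`, conjugation law `a^g = a + χ_Δ`, Hilbert 90,
`θ = β·gβ·√Δ`, `f·gf = ±Δ`, NS2 non-norm lemma). [cite: GreenbergLNM1716, §3 Lemma 3.4 (proof, p. 89)]
[cite: Kramer1981, §2 Prop. 5 (p. 127)] [cite: NeukirchANT1999, Ch. V §1 Thm. (1.1)] -/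
theorem localRed_eq_zero_of_two_nsmul_eq_smul_sub (W : WeierstrassCurve ℚ) [W.IsGloballyMinimal] [W.IsElliptic]
    (hgo : GoodOrd W 2) (hΔ8 : ∃ m : ℤ, (m : ℚ) = W.Δ ∧ (m % 8 = 3 ∨ m % 8 = 5))
    (κ : ZpExtension ℚ 2) (hκ : κ.IsCyclotomic) (v : HeightOneSpectrum (𝓞 ℚ))
    (h2v : ((2 : ℕ) : 𝓞 ℚ) ∈ v.asIdeal) (n : ℕ)
    {w : Valuation (AlgebraicClosure (v.adicCompletion ℚ)) ℝ≥0}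
    (hw : ∀ z, (w z : ℝ) = spectralNorm (v.adicCompletion ℚ) (AlgebraicClosure (v.adicCompletion ℚ)) z)
    (red₀ : localPoints W (v.adicCompletion ℚ) →+
      (((integralModelInt W).map (algebraMap ℤ ↥w.valuationSubring)).map
        (IsLocalRing.residue ↥w.valuationSubring)).toAffine.Point)
    (hred₀ : ∀ P : localPoints W (v.adicCompletion ℚ), red₀ P =
      ((integralModelInt W).map (algebraMap ℤ ↥w.valuationSubring)).reducePoint
        (Affine.Point.congrEquiv (localIntModel_baseChange W w.valuationSubring).symm P))
    {g : absoluteGaloisGroup (v.adicCompletion ℚ)} (hgI : g ∈ absInertia (v.adicCompletion ℚ))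
    (hgn : g ∈ localSubgroup (κ.layerSubgroup n) (v.adicCompletion ℚ))
    (hgen : ∀ U : Subgroup (absoluteGaloisGroup (v.adicCompletion ℚ)),
      IsOpen (U : Set (absoluteGaloisGroup (v.adicCompletion ℚ))) →
        localSubgroup κ.kerSubgroup (v.adicCompletion ℚ) ≤ U → g ∈ U →
          localSubgroup (κ.layerSubgroup n) (v.adicCompletion ℚ) ≤ U)
    {x y : localPoints W (v.adicCompletion ℚ)}
    (hx : ∀ h ∈ localSubgroup κ.kerSubgroup (v.adicCompletion ℚ), h • x = x)
    (hy : ∀ h ∈ localSubgroup κ.kerSubgroup (v.adicCompletion ℚ), h • y = y)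
    (hrel : 2 • x = g • y - y) : red₀ x = 0 := by
  -- ### notation
  let K := v.adicCompletion ℚ
  let Kb := AlgebraicClosure (v.adicCompletion ℚ)
  let P : Type := localPoints W K
  let Hn : Subgroup (absoluteGaloisGroup K) := localSubgroup (κ.layerSubgroup n) K
  let Hn1 : Subgroup (absoluteGaloisGroup K) := localSubgroup (κ.layerSubgroup (n + 1)) K
  let Hi : Subgroup (absoluteGaloisGroup K) := localSubgroup κ.kerSubgroup K
  let γ : Hn := ⟨g, hgn⟩
  haveI : Fact (Nat.Prime 2) := ⟨Nat.prime_two⟩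
  by_contra hx0
  -- ### the good ordinary setting: the `2`-torsion package, the Frobenius in `H_∞`, `red₀` is `g`-invariant
  have hord : W.HasGoodReductionAtPrime 2 ∧ ¬ ((2 : ℕ) : ℤ) ∣ W.frobeniusTrace 2 := hgo
  have hΔ : ¬ ((2 : ℕ) : ℤ) ∣ minimalDiscriminantInt W :=
    W.not_dvd_minimalDiscriminantInt_of_hasGoodReductionAtPrime' 2 hord.1
  have hΔu := W.isUnit_Δ_localIntModel h2v hw hΔ
  obtain ⟨hstab, hdiv₁, P₁, hP₁0, hP₁two, hP₁ne, hP₁fix, hA12, hmove, hZp⟩ :=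
    goodOrd_two_torsion_package W hgo v h2v hw red₀ hred₀
  obtain ⟨𝔐, h𝔐⟩ := v.localPrimesAbove_nonempty
  have hϖ : Irreducible ((2 : ℕ) : v.adicCompletionIntegers ℚ) := irreducible_natCast_adicCompletionIntegers_rat h2v
  obtain ⟨τ, hτ, hτfix⟩ := exists_isArithFrobAt_forall_smul_eq hw h𝔐 h2v hϖ
  have hτHi : τ ∈ Hi :=
    (mem_localSubgroup_iff _ _ τ).mpr (resGal_mem_kerSubgroup_of_forall_smul_rootOfUnity_eq hκ hτfix)
  have hgred : ∀ Q : P, red₀ (g • Q) = red₀ Q := fun Q ↦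
    localRed_smul_eq_of_mem_absInertia W hw red₀ hred₀ h2v h𝔐 hgI Q
  -- ### (1) normalise `red₀ y = 0` and halve `y` in the formal group
  have hτy : τ • y = y := hy τ hτHi
  obtain ⟨P₀, hP₀fix, hP₀⟩ := exists_fixed_localRed_eq W hw hΔu red₀ hred₀ h2v hΔ h𝔐 hτ y (by rw [hτy])
  obtain ⟨y', hy'i, hrel', hy'0⟩ : ∃ y' : P, (∀ h ∈ Hi, h • y' = y') ∧ 2 • x = g • y' - y' ∧ red₀ y' = 0 :=
    ⟨y - P₀, fun h hh ↦ by rw [smul_sub, hy h hh, hP₀fix],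
      by rw [hrel, smul_sub, hP₀fix]; abel, by rw [map_sub, hP₀, sub_self]⟩
  obtain ⟨Y, hY0, hYy⟩ := hdiv₁ y' hy'0
  -- ### (2) the cocycle `ξ = c − ∂Y` on `H_n`
  obtain ⟨c, -, hcg, hcH1, hc2⟩ := exists_contOneCocycles_inflate_of_pow_smul hκ v h2v W n hgn hgen hZp red₀ hgred
    hx hy'i hrel'
  obtain ⟨ξ, hξ_apply⟩ : ∃ ξ : Hn → P, ∀ σ, ξ σ = c.1 σ - ((σ : absoluteGaloisGroup K) • Y - Y) :=
    ⟨_, fun _ ↦ rfl⟩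
  have hξ2 : ∀ σ : Hn, 2 • ξ σ = 0 := fun σ ↦ by
    rw [hξ_apply, smul_sub, hc2, smul_sub (2 : ℕ) ((σ : absoluteGaloisGroup K) • Y) Y, smul_comm, hYy, sub_self]
  have hξmul : ∀ σ τ : Hn, ξ (σ * τ) = ξ σ + (σ : absoluteGaloisGroup K) • ξ τ := fun σ τ ↦ by
    have h1 := c.2 σ τ
    change c.1 (σ * τ) = c.1 σ + (σ : absoluteGaloisGroup K) • c.1 τ at h1
    rw [hξ_apply, hξ_apply, hξ_apply, h1, Subgroup.coe_mul, mul_smul, smul_sub, smul_sub]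
    abel
  have hξcont : Continuous ξ := by
    have hξeq : ξ = fun σ ↦ c.1 σ - ((σ : absoluteGaloisGroup K) • Y - Y) := funext hξ_apply
    rw [hξeq]
    exact c.1.continuous.sub (((continuous_smul_localPoints W K Y).comp continuous_subtype_val).sub continuous_const)
  -- on `H_{n+1}`: `ξ ∈ {0, P₁}`
  have hle1 : Hn1 ≤ Hn := MultTowerSP1.localSubgroup_layerSubgroup_antitone κ K (Nat.le_succ n)
  have hξH1 : ∀ σ : Hn, (σ : absoluteGaloisGroup K) ∈ Hn1 → ξ σ = 0 ∨ ξ σ = P₁ := fun σ hσ ↦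
    hA12 _ (by rw [hξ_apply, map_sub, hcH1 σ hσ, map_sub, hstab _ _ hY0, hY0, sub_self, sub_zero]) (hξ2 σ)
  have hξH1fix : ∀ (σ : Hn) (ρ : absoluteGaloisGroup K), (σ : absoluteGaloisGroup K) ∈ Hn1 → ρ • ξ σ = ξ σ :=
    fun σ ρ hσ ↦ by
      rcases hξH1 σ hσ with h | h
      · rw [h, smul_zero]
      · rw [h, hP₁fix]
  -- at `g`: `Q₀ := ξ(g)` is a `2`-torsion point with NONZERO reduction
  obtain ⟨Q₀, hQ₀_def⟩ : ∃ Q : P, Q = ξ γ := ⟨_, rfl⟩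
  have hQ₀two : 2 • Q₀ = 0 := by rw [hQ₀_def]; exact hξ2 γ
  have hQ₀red : red₀ Q₀ ≠ 0 := by
    rw [hQ₀_def, hξ_apply, hcg, map_sub, map_sub, hstab _ _ hY0, hY0, sub_self, sub_zero]
    exact hx0
  -- ### (3) the character of `Q₀` on `Γ`: `σ Q₀ = Q₀ + b σ`, `b σ ∈ {0, P₁}` additive
  obtain ⟨b, hb_apply⟩ : ∃ b : absoluteGaloisGroup K → P, ∀ σ, b σ = σ • Q₀ - Q₀ := ⟨_, fun _ ↦ rfl⟩
  have hb01 : ∀ σ, b σ = 0 ∨ b σ = P₁ := fun σ ↦ by rw [hb_apply]; exact hmove σ Q₀ hQ₀two hQ₀red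
  have hbfix : ∀ σ ρ : absoluteGaloisGroup K, ρ • b σ = b σ := fun σ ρ ↦ by
    rcases hb01 σ with h | h
    · rw [h, smul_zero]
    · rw [h, hP₁fix]
  have hbmul : ∀ σ ρ : absoluteGaloisGroup K, b (σ * ρ) = b σ + b ρ := fun σ ρ ↦ by
    have h : b (σ * ρ) = b σ + σ • b ρ := by rw [hb_apply, hb_apply, hb_apply, mul_smul, smul_sub]; abel
    rw [h, hbfix]
  have hb1 : b 1 = 0 := by rw [hb_apply, one_smul, sub_self]
  have hbconj : ∀ σ : absoluteGaloisGroup K, b (g * σ * g⁻¹) = b σ := fun σ ↦ by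
    rw [hbmul, hbmul]
    have h : b g + b g⁻¹ = 0 := by rw [← hbmul, mul_inv_cancel, hb1]
    calc b g + b σ + b g⁻¹ = b σ + (b g + b g⁻¹) := by abel
      _ = b σ := by rw [h, add_zero]
  -- elements of `{0, P₁}` are their own negatives
  have hnegP : ∀ e : P, (e = 0 ∨ e = P₁) → -e = e := fun e he ↦ by
    rcases he with rfl | rfl
    · exact neg_zero
    · rw [neg_eq_iff_add_eq_zero, ← two_nsmul, hP₁two]
  -- ### the CONJUGATION LAW `ξ(gτg⁻¹) = ξ(τ) + b(τ)` for `τ ∈ H_{n+1}`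
  haveI hHn1N : Hn1.Normal := by
    change (localSubgroup (κ.layerSubgroup (n + 1)) K).Normal
    rw [localSubgroup_eq_comap]; exact Subgroup.Normal.comap inferInstance _
  have hconjmem : ∀ σ : absoluteGaloisGroup K, σ ∈ Hn1 → g * σ * g⁻¹ ∈ Hn1 := fun σ hσ ↦ hHn1N.conj_mem σ hσ g
  have hconjmem' : ∀ σ : absoluteGaloisGroup K, σ ∈ Hn1 → g⁻¹ * σ * g ∈ Hn1 := fun σ hσ ↦ by
    have := hHn1N.conj_mem σ hσ g⁻¹
    rwa [inv_inv] at this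
  have hlaw : ∀ (σ : absoluteGaloisGroup K) (hσ : σ ∈ Hn1),
      ξ ⟨g * σ * g⁻¹, hle1 (hconjmem σ hσ)⟩ = ξ ⟨σ, hle1 hσ⟩ + b σ := by
    intro σ hσ
    -- `γ * σ' = (gσg⁻¹)' * γ` in `H_n`
    have hprod : (γ * ⟨σ, hle1 hσ⟩ : Hn) = ⟨g * σ * g⁻¹, hle1 (hconjmem σ hσ)⟩ * γ :=
      Subtype.ext (by change g * σ = g * σ * g⁻¹ * g; group)
    have h1 := hξmul γ ⟨σ, hle1 hσ⟩
    have h2 := hξmul ⟨g * σ * g⁻¹, hle1 (hconjmem σ hσ)⟩ γ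
    rw [hprod, h2, ← hQ₀_def] at h1
    -- `h1 : ξ(gσg⁻¹) + (gσg⁻¹) • Q₀ = Q₀ + g • ξ σ`
    have h1' : ξ ⟨g * σ * g⁻¹, hle1 (hconjmem σ hσ)⟩ + (g * σ * g⁻¹) • Q₀ = Q₀ + g • ξ ⟨σ, hle1 hσ⟩ := h1
    rw [hξH1fix ⟨σ, hle1 hσ⟩ g hσ] at h1'
    have h3 : (g * σ * g⁻¹) • Q₀ = Q₀ + b σ := by rw [← hbconj σ, hb_apply]; abel
    rw [h3] at h1'
    -- so `ξ(gσg⁻¹) = ξ σ - b σ = ξ σ + b σ`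
    have h4 : ξ ⟨g * σ * g⁻¹, hle1 (hconjmem σ hσ)⟩ - (ξ ⟨σ, hle1 hσ⟩ - b σ) = 0 := by
      have h5 := sub_eq_zero.mpr h1'
      calc ξ ⟨g * σ * g⁻¹, hle1 (hconjmem σ hσ)⟩ - (ξ ⟨σ, hle1 hσ⟩ - b σ)
          = ξ ⟨g * σ * g⁻¹, hle1 (hconjmem σ hσ)⟩ + (Q₀ + b σ) - (Q₀ + ξ ⟨σ, hle1 hσ⟩) := by abel
        _ = 0 := h5
    rw [sub_eq_zero.mp h4, sub_eq_add_neg, hnegP _ (hb01 σ)]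
  -- ### the ZMod-2 bookkeeping: `toZ e = [e ≠ 0]` on `{0, P₁}`
  obtain ⟨toZ, htoZ⟩ : ∃ t : P → ZMod 2, ∀ e, t e = if e = 0 then 0 else 1 := ⟨_, fun _ ↦ rfl⟩
  have htoZ0 : toZ 0 = 0 := by rw [htoZ, if_pos rfl]
  have htoZ1 : toZ P₁ = 1 := by rw [htoZ, if_neg hP₁ne]
  have htoZadd : ∀ e e' : P, (e = 0 ∨ e = P₁) → (e' = 0 ∨ e' = P₁) → toZ (e + e') = toZ e + toZ e' := by
    rintro e e' (rfl | rfl) (rfl | rfl)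
    · rw [add_zero, htoZ0, add_zero]
    · rw [zero_add, htoZ1, htoZ0, zero_add]
    · rw [add_zero, htoZ1, htoZ0, add_zero]
    · rw [← two_nsmul, hP₁two, htoZ0, htoZ1]; rfl
  -- the character `a` of `H_{n+1}` and the character `χ` of `Γ`
  obtain ⟨a, ha_apply⟩ : ∃ a : Hn1 → ZMod 2, ∀ σ, a σ = toZ (ξ ⟨σ.1, hle1 σ.2⟩) := ⟨_, fun _ ↦ rfl⟩
  obtain ⟨χ, hχ_apply⟩ : ∃ χ : absoluteGaloisGroup K → ZMod 2, ∀ σ, χ σ = toZ (b σ) := ⟨_, fun _ ↦ rfl⟩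
  have ha_cont : Continuous a := by
    have h1 : Continuous (fun σ : Hn1 ↦ ξ ⟨σ.1, hle1 σ.2⟩) :=
      hξcont.comp (continuous_subtype_val.subtype_mk _)
    have ha_eq : a = toZ ∘ (fun σ : Hn1 ↦ ξ ⟨σ.1, hle1 σ.2⟩) := funext fun σ ↦ ha_apply σ
    rw [ha_eq]
    exact (continuous_of_discreteTopology (f := toZ)).comp h1
  have ha_add : ∀ σ ρ : Hn1, a (σ * ρ) = a σ + a ρ := fun σ ρ ↦ by
    rw [ha_apply, ha_apply, ha_apply]
    have h : (⟨(σ * ρ : Hn1).1, hle1 (σ * ρ).2⟩ : Hn) = ⟨σ.1, hle1 σ.2⟩ * ⟨ρ.1, hle1 ρ.2⟩ := Subtype.ext rfl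
    rw [h, hξmul, hξH1fix ⟨ρ.1, hle1 ρ.2⟩ _ ρ.2]
    exact htoZadd _ _ (hξH1 ⟨σ.1, hle1 σ.2⟩ σ.2) (hξH1 ⟨ρ.1, hle1 ρ.2⟩ ρ.2)
  have hlawZ : ∀ σ : Hn1, a ⟨g⁻¹ * σ.1 * g, hconjmem' σ.1 σ.2⟩ = a σ + χ σ.1 := by
    intro σ
    -- apply the law to `σ' = g⁻¹ σ g`: `ξ σ = ξ σ' + b σ'`, `b σ' = b σ`
    have h := hlaw (g⁻¹ * σ.1 * g) (hconjmem' σ.1 σ.2)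
    have hgg : g * (g⁻¹ * σ.1 * g) * g⁻¹ = σ.1 := by group
    have hb' : b (g⁻¹ * σ.1 * g) = b σ.1 := by
      have := hbconj (g⁻¹ * σ.1 * g); rw [hgg] at this; exact this.symm
    have hmem : (⟨g * (g⁻¹ * σ.1 * g) * g⁻¹, hle1 (hconjmem _ (hconjmem' σ.1 σ.2))⟩ : Hn) = ⟨σ.1, hle1 σ.2⟩ :=
      Subtype.ext hgg
    rw [hmem] at h
    -- `h : ξ σ = ξ σ' + b σ`
    rw [ha_apply, ha_apply, hχ_apply, h, hb',
      htoZadd _ _ (hξH1 ⟨g⁻¹ * σ.1 * g, hle1 (hconjmem' σ.1 σ.2)⟩ (hconjmem' σ.1 σ.2)) (hb01 σ.1)]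
    -- in `ZMod 2`: `z₁ = (z₁ + z₂) + z₂`
    generalize toZ (ξ ⟨g⁻¹ * σ.1 * g, hle1 (hconjmem' σ.1 σ.2)⟩) = z₁
    generalize toZ (b σ.1) = z₂
    have hz : ∀ z : ZMod 2, z + z = 0 := fun z ↦ CharTwo.add_self_eq_zero z
    calc z₁ = z₁ + (z₂ + z₂) := by rw [hz, add_zero]
      _ = z₁ + z₂ + z₂ := by rw [add_assoc]
  -- ### (4) the square root of `Δ` and its Kummer character `χ`
  -- coordinates of `P₁` and `Q₀`
  have hQ₀ne : Q₀ ≠ 0 := fun h ↦ hQ₀red (by rw [h, map_zero])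
  obtain ⟨r, y₁, h₁, hP₁eq⟩ := localPoints.exists_eq_some_of_ne_zero W P₁ hP₁ne
  obtain ⟨x₀, y₀, h₀, hQ₀eq⟩ := localPoints.exists_eq_some_of_ne_zero W Q₀ hQ₀ne
  have h2Kb : (2 : Kb) ≠ 0 := by
    have h := (algebraMap ℚ Kb).injective.ne (two_ne_zero (α := ℚ)); simpa using h
  have h4Kb : (4 : Kb) ≠ 0 := by
    have h := (algebraMap ℚ Kb).injective.ne (show (4 : ℚ) ≠ 0 by norm_num); simpa using h
  haveI hVell : (W.baseChange Kb).IsElliptic := inferInstance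
  have hΔmap : (W.baseChange Kb).Δ = algebraMap ℚ Kb W.Δ := W.map_Δ (algebraMap ℚ Kb)
  have hb₂map : (W.baseChange Kb).b₂ = algebraMap ℚ Kb W.b₂ := W.map_b₂ (algebraMap ℚ Kb)
  have hb₄map : (W.baseChange Kb).b₄ = algebraMap ℚ Kb W.b₄ := W.map_b₄ (algebraMap ℚ Kb)
  have hrroot : 4 * r ^ 3 + (W.baseChange Kb).b₂ * r ^ 2 + 2 * (W.baseChange Kb).b₄ * r + (W.baseChange Kb).b₆ = 0 :=
    fourCubic_eq_zero_of_two_nsmul_eq_zero (W.baseChange Kb) h₁ (by rw [← hP₁eq]; exact hP₁two)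
  have hx₀root : 4 * x₀ ^ 3 + (W.baseChange Kb).b₂ * x₀ ^ 2 + 2 * (W.baseChange Kb).b₄ * x₀ + (W.baseChange Kb).b₆ = 0 :=
    fourCubic_eq_zero_of_two_nsmul_eq_zero (W.baseChange Kb) h₀ (by rw [← hQ₀eq]; exact hQ₀two)
  have hx₀r : x₀ ≠ r := by
    intro hxr
    have hQP : Q₀ = P₁ := by
      rw [hQ₀eq, hP₁eq]
      exact localPoints.some_eq_of_X_eq_of_two_nsmul_eq_zero W K (by rw [← hP₁eq]; exact hP₁two) hxr
    exact hQ₀red (by rw [hQP, hP₁0])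
  obtain ⟨hu0, hs2⟩ := sq_eq_Δ_of_two_torsion_abscissae (W.baseChange Kb) h2Kb hrroot hx₀root hx₀r
  -- name the three field elements `u`, `p`, `s = √Δ` (opaque from now on)
  obtain ⟨u, hu_def⟩ : ∃ u' : Kb, u' = 16 * (r ^ 2 + ((W.baseChange Kb).b₂ / 4 + r) * r + ((W.baseChange Kb).b₄ / 2 + ((W.baseChange Kb).b₂ / 4 + r) * r)) :=
    ⟨_, rfl⟩
  obtain ⟨pp, hpp_def⟩ : ∃ p' : Kb, p' = (W.baseChange Kb).b₂ / 4 + r := ⟨_, rfl⟩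
  obtain ⟨s, hs_def⟩ : ∃ s' : Kb, s' = u * (2 * x₀ + pp) / 4 := ⟨_, rfl⟩
  rw [← hu_def] at hu0 hs2
  rw [← hpp_def, ← hs_def] at hs2
  have hsne : s ≠ 0 := fun h ↦ by
    rw [h, zero_pow two_ne_zero] at hs2
    exact (W.baseChange Kb).isUnit_Δ.ne_zero hs2.symm
  -- Galois acts on the coordinates; it fixes `r`, `b₂`, `b₄`
  have hsmul_some : ∀ (σ : absoluteGaloisGroup K) {xx yy : Kb} (hh : (W.baseChange Kb).toAffine.Nonsingular xx yy),
      ∃ hh', σ • (show P from Affine.Point.some xx yy hh) = Affine.Point.some (σ • xx) (σ • yy) hh' :=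
    fun σ _ _ hh ↦ localPoints.exists_smul_some_eq W K σ hh
  have hσr : ∀ σ : absoluteGaloisGroup K, σ • r = r := fun σ ↦ by
    obtain ⟨hh', e⟩ := hsmul_some σ h₁
    have e' := hP₁fix σ
    rw [hP₁eq, e] at e'
    exact (Affine.Point.some.inj e').1
  have hσℚ : ∀ (σ : absoluteGaloisGroup K) (q : ℚ), σ • (algebraMap ℚ Kb q) = algebraMap ℚ Kb q := fun σ q ↦ by
    haveI : CharZero Kb := charZero_of_injective_algebraMap (algebraMap ℚ Kb).injective
    rw [absoluteGaloisGroup.smul_def, eq_ratCast, map_ratCast]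
  have hσb₂ : ∀ σ : absoluteGaloisGroup K, σ • (W.baseChange Kb).b₂ = (W.baseChange Kb).b₂ := fun σ ↦ by
    rw [hb₂map]; exact hσℚ σ _
  have hσb₄ : ∀ σ : absoluteGaloisGroup K, σ • (W.baseChange Kb).b₄ = (W.baseChange Kb).b₄ := fun σ ↦ by
    rw [hb₄map]; exact hσℚ σ _
  -- `σ` acts as a ring homomorphism: it fixes every polynomial expression in `r`, `b₂`, `b₄`
  have hsdiv : ∀ (σ : absoluteGaloisGroup K) (z₁ z₂ : Kb), σ • (z₁ / z₂) = σ • z₁ / σ • z₂ := fun σ z₁ z₂ ↦ by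
    rw [div_eq_mul_inv, smul_mul', smul_inv'', div_eq_mul_inv]
  have hσu : ∀ σ : absoluteGaloisGroup K, σ • u = u := fun σ ↦ by
    have hφ : ∀ z : Kb, σ • z = MulSemiringAction.toRingHom (absoluteGaloisGroup K) Kb σ z := fun _ ↦ rfl
    have hφr : MulSemiringAction.toRingHom (absoluteGaloisGroup K) Kb σ r = r := (hφ r).symm.trans (hσr σ)
    have hφb₂ : MulSemiringAction.toRingHom (absoluteGaloisGroup K) Kb σ (W.baseChange Kb).b₂ = (W.baseChange Kb).b₂ :=
      (hφ _).symm.trans (hσb₂ σ)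
    have hφb₄ : MulSemiringAction.toRingHom (absoluteGaloisGroup K) Kb σ (W.baseChange Kb).b₄ = (W.baseChange Kb).b₄ :=
      (hφ _).symm.trans (hσb₄ σ)
    rw [hφ, hu_def]
    simp only [map_mul, map_add, map_div₀, map_pow, map_ofNat, hφr, hφb₂, hφb₄]
  have hσpp : ∀ σ : absoluteGaloisGroup K, σ • pp = pp := fun σ ↦ by
    rw [hpp_def, smul_add, hsdiv, hσb₂, hσr]
    have h4 : σ • (4 : Kb) = 4 := by
      rw [show (4 : Kb) = ((4 : ℕ) : Kb) by norm_num, absoluteGaloisGroup.smul_def, map_natCast]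
    rw [h4]
  have hσs : ∀ σ : absoluteGaloisGroup K, σ • s = u * (2 * (σ • x₀) + pp) / 4 := fun σ ↦ by
    rw [hs_def, hsdiv, smul_mul', hσu, smul_add, smul_mul', hσpp]
    have h4 : σ • (4 : Kb) = 4 := by
      rw [show (4 : Kb) = ((4 : ℕ) : Kb) by norm_num, absoluteGaloisGroup.smul_def, map_natCast]
    have h2 : σ • (2 : Kb) = 2 := by
      rw [show (2 : Kb) = ((2 : ℕ) : Kb) by norm_num, absoluteGaloisGroup.smul_def, map_natCast]
    rw [h4, h2]
  -- `σ s = s ↔ σ x₀ = x₀ ↔ σ Q₀ = Q₀ ↔ b σ = 0`; otherwise `σ s = −s`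
  have hs_inj : ∀ t : Kb, u * (2 * t + pp) / 4 = s → t = x₀ := fun t ht ↦ by
    rw [hs_def] at ht
    have h1 : u * (2 * t + pp) = u * (2 * x₀ + pp) := by
      have := congrArg (· * (4 : Kb)) ht
      simpa only [div_mul_cancel₀ _ h4Kb] using this
    have h2 := mul_left_cancel₀ hu0 h1
    have h3 : 2 * t = 2 * x₀ := add_right_cancel h2
    exact mul_left_cancel₀ h2Kb h3
  have hfixQ₀_iff : ∀ σ : absoluteGaloisGroup K, σ • Q₀ = Q₀ ↔ σ • x₀ = x₀ := fun σ ↦ by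
    obtain ⟨hh', e⟩ := hsmul_some σ h₀
    rw [hQ₀eq, e]
    constructor
    · intro h; exact (Affine.Point.some.inj h).1
    · intro h
      exact localPoints.some_eq_of_X_eq_of_two_nsmul_eq_zero W K (by rw [← hQ₀eq]; exact hQ₀two) h
  have hσs_cases : ∀ σ : absoluteGaloisGroup K, σ • s = if b σ = 0 then s else -s := by
    intro σ
    by_cases hbσ : b σ = 0
    · rw [if_pos hbσ]
      have hQ : σ • Q₀ = Q₀ := sub_eq_zero.mp (by rw [← hb_apply]; exact hbσ)
      rw [hσs, (hfixQ₀_iff σ).mp hQ, ← hs_def]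
    · rw [if_neg hbσ]
      have hsq : (σ • s) ^ 2 = s ^ 2 := by
        rw [← smul_pow', hs2, hΔmap]; exact hσℚ σ _
      rcases sq_eq_sq_iff_eq_or_eq_neg.mp hsq with h | h
      · exfalso
        rw [hσs] at h
        have hQ : σ • Q₀ = Q₀ := (hfixQ₀_iff σ).mpr (hs_inj _ h)
        exact hbσ (by rw [hb_apply]; exact sub_eq_zero.mpr hQ)
      · exact h
  -- ### (5)–(6) the Kummer endgame (BRICK ε3 `false_of_kummer_conjugation_law`)
  have h10 : (1 : ZMod 2) ≠ 0 := one_ne_zero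
  have hχb : ∀ σ : absoluteGaloisGroup K, b σ = 0 ↔ χ σ = 0 := fun σ ↦ by
    rw [hχ_apply, htoZ]
    constructor
    · intro h; rw [if_pos h]
    · intro h; by_contra hne; rw [if_neg hne] at h; exact h10 h
  have hσs_cases' : ∀ σ : absoluteGaloisGroup K, σ • s = if χ σ = 0 then s else -s := fun σ ↦ by
    rw [hσs_cases σ]
    by_cases h : b σ = 0
    · rw [if_pos h, if_pos ((hχb σ).mp h)]
    · rw [if_neg h, if_neg (fun h' ↦ h ((hχb σ).mpr h'))]
  obtain ⟨m, hm, hm8⟩ := hΔ8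
  have hs2m : s ^ 2 = algebraMap K Kb ((m : ℤ) : K) := by
    rw [hs2, map_intCast, hΔmap, ← hm, map_intCast]
  exact false_of_kummer_conjugation_law hκ v h2v n hgn hgen a ha_cont ha_add χ
    (fun σ hσ hσ' ↦ hlawZ ⟨σ, hσ⟩) hm8 hs2m hσs_cases'

end Summit.BirchSwinnertonDyer.BirchSwinnertonDyer.Theorems.GoodOrdTower

end
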